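import Literature.Geometry.Kaehler.CechDolbeault
import Literature.Geometry.Kaehler.HolomorphicFormsChart
import Literature.Geometry.Kaehler.DolbeaultChartAcyclic
import Literature.NumberTheory.Transcendental.NestedChartConvexCovers
import Literature.Analysis.Complex.MontelSCV
import Mathlib.Analysis.Normed.Lp.lpSpace
import Mathlib.Analysis.Normed.Operator.Compact.Basic
import HarnessLib

/-!
# Banach spaces of bounded holomorphic Čech cochains (Cartan–Serre / Grauert–Remmert VI §4)

The analytic half of the Cartan–Serre finiteness theorem `dim H^q(M, Ω^p) < ∞` for a compact
complex manifold `M`, in the original sup-norm form of H. Cartan, J.-P. Serre, *C. R. Acad. Sci.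
Paris* **237** (1953) 128–130, as organised in H. Grauert, R. Remmert, *Theorie der Steinschen
Räume* (1977), Kap. VI §4 ("Meßatlanten", Glättungslemma, Endlichkeitslemma):

* `DolbeaultLerayDatum E M` — nested finite covers `𝔘₀ ≪ 𝔘₁ ≪ 𝔘₂ ≪ 𝔘₃` of `M` on one index
  set whose finite intersections `U_{l,J}` are the chart sets of open convex sets `C_{l,J}` in
  ONE chart (centred at `ctr J`) for all levels `l`, with `closure U_{l,J} ⊆ U_{l',J}` for `l < l'`
  (`exists_nestedChartConvexCovers`); `nonempty_dolbeaultLerayDatum`.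
* `D.Bdd p l a` — the **Banach space of bounded holomorphic `a`-cochains** of level `l`:
  the cochains `c ∈ C^a(𝔘_l, Ω^p)` whose chart representatives `(c_J)̂ = (c J).inChart (ctr J)`
  are bounded on the `C_{l,J}`, with the sup norm `‖c‖ = sup_J sup_{C_{l,J}} ‖(c_J)̂‖`
  (an isometric copy of a closed subspace of `ℓ^∞`, closed because uniform limits of holomorphic
  maps are holomorphic — `SCV.differentiableOn_of_tendstoLocallyUniformlyOn` — and the type
  condition is closed); `CompleteSpace`.
* `D.res` — restriction to a lower level is a contraction; `D.delta` — the Čech differential is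
  bounded on level `l` whenever a higher level exists (the change-of-chart factors
  `tangentCoordChange` are bounded on the compact closures `closure U_{l,J} ⊆ U_{l',J}`);
* `D.exists_subseq_tendsto_res` / `D.isCompactOperator_res` — **restriction to a strictly lower
  level is a compact operator** (Montel's theorem in the fixed charts,
  `SCV.exists_strictMono_tendstoUniformlyOn_of_norm_le`, on the compact sets
  `e_J(closure U_{l,J}) ⊆ C_{l',J}`): Grauert–Remmert, Kap. VI §2.4 / Satz 4.1.
* `isCompactOperator_of_subseq` — the sequential criterion for compactness of an operator.
* Leray bookkeeping for the finiteness theorem: all `U_{l,J}` are `∂̄`-acyclic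
  (`isDolbeaultAcyclic_cechSet`, from `isDolbeaultAcyclic_chartSet`), the Leray isomorphisms
  `D.leray l q : H^q(A^{p,•}(M), ∂̄) ≃ H^q(𝔘_l, Ω^p)` and their naturality under restriction of
  the level (`leray_natural`); the Banach spaces of bounded cocycles `D.Zb` with the restricted
  operators `resZ` (compact), `deltaZ`, the class map `cls`, and the two inputs of the abstract
  finiteness theorem: every class has a bounded representative one level down
  (`exists_cls_resZ_eq`) and the controlled solvability `res res x = res y + δ w`
  (`exists_resZ_resZ_eq_add_deltaZ`, `exists_resZ_resZ_eq`) — Grauert–Remmert, Kap. VI §4.3.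

Everything is proved; the only definitions are the datum, the spaces and the two operators.

## References

* H. Grauert, R. Remmert, *Theorie der Steinschen Räume* (1977), Kap. VI §§1–4. [GrauertRemmert1977]
* H. Cartan, J.-P. Serre, Un théorème de finitude concernant les variétés analytiques compactes,
  C. R. Acad. Sci. Paris 237 (1953) 128–130. [CartanSerre1953]
* L. Hörmander, *An Introduction to Complex Analysis in Several Variables* (1973), §2.2. [HormanderSCV1973]
-/

noncomputable section

open scoped Manifold ContDiff Topology
open Set Filter Function Metric Literature.NumberTheory.Transcendental Literature.Analysis.Complex
  Literature.Algebra.Homology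

namespace Literature.Geometry.Kaehler

/-! ### Two general lemmas -/

section General

variable {X Y : Type*} [NormedAddCommGroup X] [NormedSpace ℂ X] [NormedAddCommGroup Y] [NormedSpace ℂ Y]

/-- **Sequential criterion for compact operators**: if every sequence in the unit ball has a
subsequence whose images converge, the operator is compact (the closure of the image of the unit
ball is sequentially compact). [folklore] -/
theorem isCompactOperator_of_subseq (T : X →L[ℂ] Y)
    (hT : ∀ u : ℕ → X, (∀ n, ‖u n‖ ≤ 1) →
      ∃ (y : Y) (φ : ℕ → ℕ), StrictMono φ ∧ Tendsto (fun n ↦ T (u (φ n))) atTop (𝓝 y)) :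
    IsCompactOperator T := by
  refine (isCompactOperator_iff_isCompact_closure_image_closedBall (T : X →ₗ[ℂ] Y) one_pos).2 ?_
  apply IsSeqCompact.isCompact
  intro v hv
  have hv' : ∀ n : ℕ, ∃ x : X, ‖x‖ ≤ 1 ∧ dist (v n) (T x) < 1 / ((n : ℝ) + 1) := fun n ↦ by
    obtain ⟨y, ⟨x, hx, rfl⟩, hd⟩ := Metric.mem_closure_iff.1 (hv n) (1 / ((n : ℝ) + 1))
      Nat.one_div_pos_of_nat
    exact ⟨x, mem_closedBall_zero_iff.1 hx, hd⟩
  choose x hx1 hxd using hv'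
  obtain ⟨y, φ, hφ, hy⟩ := hT x hx1
  refine ⟨y, mem_closure_of_tendsto hy (Eventually.of_forall fun n ↦
    ⟨x (φ n), mem_closedBall_zero_iff.2 (hx1 _), rfl⟩), φ, hφ, ?_⟩
  have h0 : Tendsto (fun n ↦ dist (T (x (φ n))) (v (φ n))) atTop (𝓝 0) := by
    refine squeeze_zero (fun n ↦ dist_nonneg) (fun n ↦ ?_)
      (tendsto_one_div_add_atTop_nhds_zero_nat.comp hφ.tendsto_atTop)
    rw [dist_comm]
    exact (hxd (φ n)).le
  exact hy.congr_dist h0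

variable {E : Type*} [NormedAddCommGroup E] [NormedSpace ℂ E] [FiniteDimensional ℂ E]
  {F : Type*} [NormedAddCommGroup F] [NormedSpace ℂ F] [CompleteSpace F] [ProperSpace F]

/-- **Montel's theorem for finitely many families at once** (one common subsequence): a diagonal
over a finite set of Montel extractions. [cite: HormanderSCV1973, §2.2 (Thm 2.2.7)] -/
theorem exists_strictMono_tendstoUniformlyOn_finset {τ : Type*} (T : Finset τ) {Uo K : τ → Set E}
    (hUo : ∀ t, IsOpen (Uo t)) (hK : ∀ t, IsCompact (K t)) (hKU : ∀ t, K t ⊆ Uo t)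
    {f : ℕ → τ → E → F} {Mb : ℝ} (hf : ∀ n t, DifferentiableOn ℂ (f n t) (Uo t))
    (hM : ∀ n t, ∀ z ∈ Uo t, ‖f n t z‖ ≤ Mb) :
    ∃ (g : τ → E → F) (φ : ℕ → ℕ), StrictMono φ ∧ ∀ t ∈ T, DifferentiableOn ℂ (g t) (Uo t) ∧
      (∀ z ∈ Uo t, ‖g t z‖ ≤ Mb) ∧ TendstoUniformlyOn (fun n ↦ f (φ n) t) (g t) atTop (K t) := by
  classical
  induction T using Finset.induction_on with
  | empty => exact ⟨fun _ _ ↦ 0, id, strictMono_id, fun t ht ↦ absurd ht (Finset.notMem_empty t)⟩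
  | insert t T htT ih =>
    obtain ⟨g, φ, hφ, hg⟩ := ih
    obtain ⟨g', ψ, hψ, hg'd, hg'b, hlim⟩ := SCV.exists_strictMono_tendstoUniformlyOn_of_norm_le (hUo t)
      (hK t) (hKU t) (f := fun n ↦ f (φ n) t) (fun n ↦ hf (φ n) t) (fun n ↦ hM (φ n) t)
    refine ⟨update g t g', φ ∘ ψ, hφ.comp hψ, fun t' ht' ↦ ?_⟩
    rcases Finset.mem_insert.1 ht' with rfl | ht'T
    · rw [update_self]
      exact ⟨hg'd, hg'b, hlim⟩
    · have hne : t' ≠ t := fun h ↦ htT (h ▸ ht'T)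
      rw [update_of_ne hne]
      obtain ⟨h1, h2, h3⟩ := hg t' ht'T
      exact ⟨h1, h2, fun u hu ↦ hψ.tendsto_atTop.eventually (h3 u hu)⟩

end General

variable {E : Type*} [NormedAddCommGroup E] [NormedSpace ℂ E]
  {M : Type*} [TopologicalSpace M] [ChartedSpace E M]

/-! ### Chart-level lemmas -/

section Chart

variable [IsManifold 𝓘(ℝ, E) ∞ M] {k : ℕ}

omit [IsManifold 𝓘(ℝ, E) ∞ M] in
/-- The target of the extended chart of the self-model is the target of the chart. [folklore] -/
theorem extChartAt_target_eq_chartAt_target (x : M) :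
    (extChartAt 𝓘(ℝ, E) x).target = (chartAt E x).target := by
  rw [extChartAt_target, ModelWithCorners.Boundaryless.range_eq_univ, inter_univ,
    modelWithCornersSelf_coe_symm, preimage_id]

/-- The representative of a restricted form at a point over the restriction set. [folklore] -/
theorem inChart_restr_of_symm_mem (α : MForm 𝓘(ℝ, E) M ℂ k) {x₀ : M} {W : Set M} {y : E}
    (hy : y ∈ (extChartAt 𝓘(ℝ, E) x₀).target) (hW : (extChartAt 𝓘(ℝ, E) x₀).symm y ∈ W) :
    (α.restr W).inChart x₀ y = α.inChart x₀ y := by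
  rw [MForm.inChart_eq_of_mem_target _ hy, MForm.inChart_eq_of_mem_target _ hy,
    MForm.restr_apply_of_mem _ hW]

omit [IsManifold 𝓘(ℝ, E) ∞ M] in
/-- The representative is compatible with subtraction. [folklore] -/
theorem inChart_sub' (α β : MForm 𝓘(ℝ, E) M ℂ k) (x₀ : M) :
    (α - β).inChart x₀ = α.inChart x₀ - β.inChart x₀ := by
  funext y
  ext v
  simp only [MForm.inChart_apply, Pi.sub_apply, ContinuousAlternatingMap.sub_apply]

/-- **The change-of-chart factor is bounded on compact sets**: for a compact `K` inside the
sources of the charts at `x₀` and `x₁` there is `A ≥ 0` with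
`‖α̂^{(x₀)}(e₀ m)‖ ≤ A ‖α̂^{(x₁)}(e₁ m)‖` for all forms `α` and `m ∈ K` (the representatives
differ by the pull-back along `tangentCoordChange`, `MForm.inChart_eq_comp_inChart`, whose operator
norm is bounded on `K`). [cite: GrauertRemmert1977, Kap. VI §2.2] -/
theorem exists_norm_inChart_le_of_isCompact {x₀ x₁ : M} {K : Set M} (hK : IsCompact K)
    (h₀ : K ⊆ (extChartAt 𝓘(ℝ, E) x₀).source) (h₁ : K ⊆ (extChartAt 𝓘(ℝ, E) x₁).source) (k : ℕ) :
    ∃ A : ℝ, 0 ≤ A ∧ ∀ (α : MForm 𝓘(ℝ, E) M ℂ k), ∀ m ∈ K,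
      ‖α.inChart x₀ (extChartAt 𝓘(ℝ, E) x₀ m)‖ ≤ A * ‖α.inChart x₁ (extChartAt 𝓘(ℝ, E) x₁ m)‖ := by
  obtain ⟨B, hB⟩ := hK.exists_bound_of_continuousOn
    ((continuousOn_tangentCoordChange (I := 𝓘(ℝ, E)) x₀ x₁).mono (subset_inter h₀ h₁))
  refine ⟨max B 0 ^ k, pow_nonneg (le_max_right _ _) _, fun α m hm ↦ ?_⟩
  have hy : extChartAt 𝓘(ℝ, E) x₀ m ∈ (extChartAt 𝓘(ℝ, E) x₀).target := (extChartAt 𝓘(ℝ, E) x₀).map_source (h₀ hm)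
  have hmm : (extChartAt 𝓘(ℝ, E) x₀).symm (extChartAt 𝓘(ℝ, E) x₀ m) = m := (extChartAt 𝓘(ℝ, E) x₀).left_inv (h₀ hm)
  have h := MForm.inChart_eq_comp_inChart α hy (by rw [hmm]; exact h₁ hm)
  rw [hmm] at h
  rw [h]
  refine (ContinuousAlternatingMap.norm_compContinuousLinearMap_le _ _).trans ?_
  rw [Fintype.card_fin, mul_comm]
  refine mul_le_mul_of_nonneg_right (pow_le_pow_left₀ (norm_nonneg _) ((hB m hm).trans (le_max_left _ _)) _)
    (norm_nonneg _)

end Chart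

/-! ### Holomorphic forms on a set that is a chart set -/

section HolChart

variable [FiniteDimensional ℂ E] [T2Space M] [IsManifold 𝓘(ℂ, E) ω M] [IsManifold 𝓘(ℝ, E) ∞ M]
  {p : ℕ} {W : Set M} {x₀ : M} {C : Set E}

/-- A `∂̄`-closed `(p,0)`-form on `W = chartSet x₀ C` has a holomorphic representative on `C`.
[cite: HuybrechtsCG2005, Prop. 2.6.11] -/
theorem differentiableOn_inChart_of_mem_holFormsOn (hW : IsOpen W) (hWC : W = chartSet 𝓘(ℝ, E) x₀ C)
    (hCt : C ⊆ (extChartAt 𝓘(ℝ, E) x₀).target) (hC : IsOpen C) (α : ↥(pqFormsOn E M W p 0))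
    (hα : α ∈ holFormsOn E M hW p) :
    DifferentiableOn ℂ ((α : MForm 𝓘(ℝ, E) M ℂ (p + 0)).inChart x₀) C := by
  subst hWC
  exact differentiableOn_inChart_of_localDbar_eq_zero hCt hC α ((mem_holFormsOn_iff p hW).1 hα)

/-- A holomorphic `F : C → Λ^{p,0}` transports to a holomorphic `p`-form on `W = chartSet x₀ C`.
[cite: HuybrechtsCG2005, Prop. 2.6.11] -/
theorem exists_mem_holFormsOn_ofChartOn (hW : IsOpen W) (hWC : W = chartSet 𝓘(ℝ, E) x₀ C)
    (hCt : C ⊆ (extChartAt 𝓘(ℝ, E) x₀).target) (hC : IsOpen C) {F : E → E [⋀^Fin (p + 0)]→L[ℝ] ℂ}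
    (hF : DifferentiableOn ℂ F C) (ht : ∀ y ∈ C, IsOfTypeAt p 0 (F y)) :
    ∃ h : (MForm.ofChartOn x₀ W F : MForm 𝓘(ℝ, E) M ℂ (p + 0)) ∈ pqFormsOn E M W p 0,
      (⟨_, h⟩ : ↥(pqFormsOn E M W p 0)) ∈ holFormsOn E M hW p := by
  subst hWC
  exact ⟨ofChartOn_mem_pqFormsOn hCt hC hF ht,
    (mem_holFormsOn_iff p _).2 (localDbar_ofChartOn_eq_zero hCt hC hF ht)⟩

end HolChart

/-! ### The nested Leray datum -/

variable (E M) in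
/-- **A nested Leray datum** ("Meßatlas" of Grauert–Remmert (1977), Kap. VI §4.1): four finite
open covers `𝔘₀ ≤ 𝔘₁ ≤ 𝔘₂ ≤ 𝔘₃` of `M` on one finite index set `s`, with
`closure U_{l,J} ⊆ U_{l',J}` for `l < l'` on all finite intersections, and for every tuple `J`
one chart centre `ctr J` and open convex sets `C_{l,J} ⊆ e_{ctr J}.target` with
`U_{l,J} = chartSet (ctr J) C_{l,J}` for all levels. [cite: GrauertRemmert1977, Kap. VI §4.1] -/
structure DolbeaultLerayDatum where
  /-- the finite index set of the covers -/
  s : Finset M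
  /-- the covers, by level -/
  U : Fin 4 → ↥s → Set M
  isOpen : ∀ l i, IsOpen (U l i)
  cover : ∀ l, ⋃ i, U l i = univ
  mono : ∀ l l', l ≤ l' → ∀ i, U l i ⊆ U l' i
  closure_subset : ∀ l l', l < l' → ∀ (n : ℕ) (J : Fin n → ↥s), closure (cechSet (U l) J) ⊆ cechSet (U l') J
  /-- the chart centre of a tuple -/
  ctr : ∀ a : ℕ, (Fin (a + 1) → ↥s) → M
  /-- the convex chart pieces, by tuple and level -/
  C : ∀ a : ℕ, (Fin (a + 1) → ↥s) → Fin 4 → Set E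
  C_open : ∀ a J l, IsOpen (C a J l)
  C_convex : ∀ a J l, Convex ℝ (C a J l)
  C_subset : ∀ a J l, C a J l ⊆ (extChartAt 𝓘(ℝ, E) (ctr a J)).target
  cechSet_eq : ∀ a J l, cechSet (U l) J = chartSet 𝓘(ℝ, E) (ctr a J) (C a J l)

/-- **Compact manifolds carry nested Leray data** (`exists_nestedChartConvexCovers` with four
levels; empty intersections get the empty convex piece). [cite: GrauertRemmert1977, Kap. VI §4.1] -/
theorem nonempty_dolbeaultLerayDatum [FiniteDimensional ℂ E] [T2Space M] [CompactSpace M]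
    [IsManifold 𝓘(ℝ, E) ∞ M] : Nonempty (DolbeaultLerayDatum E M) := by
  obtain ⟨s, U, hUo, hcov, hmono, hcl, hchart⟩ := exists_nestedChartConvexCovers (E := E) (M := M) 3
  choose ctr hctr using hchart
  have key : ∀ (a : ℕ) (J : Fin (a + 1) → ↥s) (l : Fin 4), ∃ C : Set E, IsOpen C ∧ Convex ℝ C ∧
      C ⊆ (extChartAt 𝓘(ℝ, E) (ctr a J)).target ∧ cechSet (U l) J = chartSet 𝓘(ℝ, E) (ctr a J) C := by
    intro a J l
    rcases (cechSet (U l) J).eq_empty_or_nonempty with h | h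
    · exact ⟨∅, isOpen_empty, convex_empty, empty_subset _, by rw [h, chartSet_empty]⟩
    · obtain ⟨C, hC, hCc, hCt, hW⟩ := hctr a J l h
      exact ⟨C, hC, hCc, by rwa [extChartAt_target_eq_chartAt_target], hW⟩
  choose C hC hCc hCt hW using key
  exact ⟨⟨s, U, hUo, hcov, hmono, hcl, ctr, C, hC, hCc, hCt, hW⟩⟩

namespace DolbeaultLerayDatum

variable (D : DolbeaultLerayDatum E M)

/-! ### Bookkeeping of the datum -/

/-- Points of `C_{l,J}` come from `U_{l,J}`. [folklore] -/
theorem symm_mem_cechSet {l : Fin 4} {a : ℕ} {J : Fin (a + 1) → ↥D.s} {y : E} (hy : y ∈ D.C a J l) :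
    (extChartAt 𝓘(ℝ, E) (D.ctr a J)).symm y ∈ cechSet (D.U l) J := by
  rw [D.cechSet_eq a J l]
  exact symm_mem_chartSet (D.C_subset a J l) hy

/-- Points of `U_{l,J}` are charted into `C_{l,J}`. [folklore] -/
theorem extChartAt_mem_C {l : Fin 4} {a : ℕ} {J : Fin (a + 1) → ↥D.s} {m : M} (hm : m ∈ cechSet (D.U l) J) :
    extChartAt 𝓘(ℝ, E) (D.ctr a J) m ∈ D.C a J l := by
  rw [D.cechSet_eq a J l] at hm
  exact (mem_chartSet_iff.1 hm).2

/-- `U_{l,J}` lies in the source of its chart. [folklore] -/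
theorem cechSet_subset_source (l : Fin 4) {a : ℕ} (J : Fin (a + 1) → ↥D.s) :
    cechSet (D.U l) J ⊆ (extChartAt 𝓘(ℝ, E) (D.ctr a J)).source := by
  rw [D.cechSet_eq a J l]
  exact chartSet_subset_source 𝓘(ℝ, E) _ _

/-- The chart pieces increase with the level. [folklore] -/
theorem C_mono {l l' : Fin 4} (h : l ≤ l') (a : ℕ) (J : Fin (a + 1) → ↥D.s) : D.C a J l ⊆ D.C a J l' := by
  intro y hy
  have h2 := D.extChartAt_mem_C (l := l') (cechSet_mono (U := D.U l') (D.mono l l' h) J (D.symm_mem_cechSet hy))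
  rwa [(extChartAt 𝓘(ℝ, E) (D.ctr a J)).right_inv (D.C_subset a J l hy)] at h2

/-- `C_{l,J}` is the chart image of `U_{l,J}`, hence inside the chart image of its closure. [folklore] -/
theorem C_subset_image_closure (l : Fin 4) {a : ℕ} (J : Fin (a + 1) → ↥D.s) :
    D.C a J l ⊆ extChartAt 𝓘(ℝ, E) (D.ctr a J) '' closure (cechSet (D.U l) J) := fun _ hy ↦
  ⟨_, subset_closure (D.symm_mem_cechSet hy), (extChartAt 𝓘(ℝ, E) (D.ctr a J)).right_inv (D.C_subset a J l hy)⟩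

/-- For `l < l'`, the closure of `U_{l,J}` is charted into `C_{l',J}`. [folklore] -/
theorem image_closure_subset_C {l l' : Fin 4} (h : l < l') {a : ℕ} (J : Fin (a + 1) → ↥D.s) :
    extChartAt 𝓘(ℝ, E) (D.ctr a J) '' closure (cechSet (D.U l) J) ⊆ D.C a J l' := by
  rintro _ ⟨m, hm, rfl⟩
  exact D.extChartAt_mem_C (D.closure_subset l l' h _ J hm)

/-- For `l < l'`, the chart image of the closure of `U_{l,J}` is compact. [folklore] -/
theorem isCompact_image_closure [CompactSpace M] {l l' : Fin 4} (h : l < l') {a : ℕ} (J : Fin (a + 1) → ↥D.s) :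
    IsCompact (extChartAt 𝓘(ℝ, E) (D.ctr a J) '' closure (cechSet (D.U l) J)) :=
  isClosed_closure.isCompact.image_of_continuousOn ((continuousOn_extChartAt _).mono
    ((D.closure_subset l l' h _ J).trans (D.cechSet_subset_source l' J)))

section Spaces

variable [FiniteDimensional ℂ E] [T2Space M] [IsManifold 𝓘(ℂ, E) ω M] [IsManifold 𝓘(ℝ, E) ∞ M] (p : ℕ)

/-! ### Holomorphic cochains: algebra -/

/-- A component of a holomorphic cochain is a `(p,0)`-form on the chart set. [folklore] -/
theorem coe_mem_pqFormsOn_chartSet {l : Fin 4} {a : ℕ} (g : CechHolForms E M (D.U l) (D.isOpen l) p a)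
    (J : Fin (a + 1) → ↥D.s) :
    ((g J : ↥(pqFormsOn E M (cechSet (D.U l) J) p 0)) : MForm 𝓘(ℝ, E) M ℂ (p + 0)) ∈
      pqFormsOn E M (chartSet 𝓘(ℝ, E) (D.ctr a J) (D.C a J l)) p 0 := by
  rw [← D.cechSet_eq a J l]
  exact (g J).1.2

/-- The Čech differential of holomorphic cochains on underlying forms. [cite: BottTu1982Forms, §8 (8.4)] -/
theorem coe_coe_cechHolδ {l : Fin 4} {a : ℕ} (g : CechHolForms E M (D.U l) (D.isOpen l) p a)
    (J : Fin (a + 2) → ↥D.s) :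
    (((cechHolδ E M (D.isOpen l) p a g J : ↥(pqFormsOn E M (cechSet (D.U l) J) p 0)) :
        MForm 𝓘(ℝ, E) M ℂ (p + 0))) =
      ∑ j : Fin (a + 2), (-1 : ℂ) ^ (j : ℕ) •
        (((g (J ∘ Fin.succAbove j) : ↥(pqFormsOn E M (cechSet (D.U l) (J ∘ Fin.succAbove j)) p 0)) :
          MForm 𝓘(ℝ, E) M ℂ (p + 0))).restr (cechSet (D.U l) J) := by
  have h : ((cechHolIncl E M (D.isOpen l) p (a + 1) (cechHolδ E M (D.isOpen l) p a g) J :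
      ↥(pqFormsOn E M (cechSet (D.U l) J) p 0)) : MForm 𝓘(ℝ, E) M ℂ (p + 0)) =
      ((cechδPQ E M (D.isOpen l) p a 0 (cechHolIncl E M (D.isOpen l) p a g) J :
        ↥(pqFormsOn E M (cechSet (D.U l) J) p 0)) : MForm 𝓘(ℝ, E) M ℂ (p + 0)) := by
    rw [cechHolIncl_cechHolδ]
  rw [coe_cechδPQ_apply] at h
  exact h

/-- `δ ∘ δ = 0` on holomorphic cochains. [cite: BottTu1982Forms, Prop. 8.3] -/
theorem cechHolδ_cechHolδ {l : Fin 4} {a : ℕ} (g : CechHolForms E M (D.U l) (D.isOpen l) p a) :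
    cechHolδ E M (D.isOpen l) p (a + 1) (cechHolδ E M (D.isOpen l) p a g) = 0 := by
  have h := (cechDolbeault E M (D.isOpen l) p).δ_δ a 0 (cechHolIncl E M (D.isOpen l) p a g)
  change cechδPQ E M (D.isOpen l) p (a + 1) 0 (cechδPQ E M (D.isOpen l) p a 0 (cechHolIncl E M (D.isOpen l) p a g)) = 0 at h
  rw [← cechHolIncl_cechHolδ, ← cechHolIncl_cechHolδ] at h
  funext J
  apply Subtype.ext
  exact congrFun h J

/-- Restriction of holomorphic cochains is transitive. [folklore] -/
theorem cechHolShrink_cechHolShrink {l l' l'' : Fin 4} (h : l ≤ l') (h' : l' ≤ l'') {a : ℕ}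
    (g : CechHolForms E M (D.U l'') (D.isOpen l'') p a) :
    cechHolShrink E M (D.isOpen l') p (D.isOpen l) (D.mono l l' h) a
        (cechHolShrink E M (D.isOpen l'') p (D.isOpen l') (D.mono l' l'' h') a g) =
      cechHolShrink E M (D.isOpen l'') p (D.isOpen l) (D.mono l l'' (h.trans h')) a g := by
  funext J
  apply Subtype.ext
  apply Subtype.ext
  change ((((g J : ↥(pqFormsOn E M (cechSet (D.U l'') J) p 0)) : MForm 𝓘(ℝ, E) M ℂ (p + 0))).restr
      (cechSet (D.U l') J)).restr (cechSet (D.U l) J) =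
    (((g J : ↥(pqFormsOn E M (cechSet (D.U l'') J) p 0)) : MForm 𝓘(ℝ, E) M ℂ (p + 0))).restr (cechSet (D.U l) J)
  rw [MForm.restr_restr_of_subset (cechSet_mono (D.mono l l' h) J)]

/-! ### The representative map and the bounded cochains -/

/-- **The chart representatives of a holomorphic cochain**, extended by zero off the chart pieces:
`(J, y) ↦ 𝟙_{C_{l,J}}(y) · (g J)̂(y)`. [cite: GrauertRemmert1977, Kap. VI §4.1] -/
def rep (l : Fin 4) (a : ℕ) :
    CechHolForms E M (D.U l) (D.isOpen l) p a →ₗ[ℂ] ((Fin (a + 1) → ↥D.s) × E → E [⋀^Fin (p + 0)]→L[ℝ] ℂ) where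
  toFun g i := (D.C a i.1 l).indicator
    ((((g i.1 : ↥(pqFormsOn E M (cechSet (D.U l) i.1) p 0)) : MForm 𝓘(ℝ, E) M ℂ (p + 0))).inChart (D.ctr a i.1)) i.2
  map_add' g g' := by
    funext i
    simp only [Pi.add_apply, Submodule.coe_add, MForm.inChart_add]
    by_cases h : i.2 ∈ D.C a i.1 l
    · simp only [indicator_of_mem h, Pi.add_apply]
    · simp only [indicator_of_notMem h, add_zero]
  map_smul' r g := by
    funext i
    simp only [Pi.smul_apply, Submodule.coe_smul, MForm.inChart_smul_complex, RingHom.id_apply]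
    by_cases h : i.2 ∈ D.C a i.1 l
    · simp only [indicator_of_mem h, Pi.smul_apply]
    · simp only [indicator_of_notMem h]
      exact (smul_zero (A := E [⋀^Fin (p + 0)]→L[ℝ] ℂ) r).symm

/-- The representative map on a chart piece. [folklore] -/
theorem rep_apply_of_mem {l : Fin 4} {a : ℕ} (g : CechHolForms E M (D.U l) (D.isOpen l) p a)
    {J : Fin (a + 1) → ↥D.s} {y : E} (hy : y ∈ D.C a J l) :
    D.rep p l a g (J, y) =
      (((g J : ↥(pqFormsOn E M (cechSet (D.U l) J) p 0)) : MForm 𝓘(ℝ, E) M ℂ (p + 0))).inChart (D.ctr a J) y :=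
  indicator_of_mem hy _

/-- The representative map off the chart pieces. [folklore] -/
theorem rep_apply_of_notMem {l : Fin 4} {a : ℕ} (g : CechHolForms E M (D.U l) (D.isOpen l) p a)
    {J : Fin (a + 1) → ↥D.s} {y : E} (hy : y ∉ D.C a J l) : D.rep p l a g (J, y) = 0 :=
  indicator_of_notMem hy _

/-- A cochain with uniformly bounded representatives has representatives in `ℓ^∞`. [folklore] -/
theorem memℓp_of_forall {l : Fin 4} {a : ℕ} {g : CechHolForms E M (D.U l) (D.isOpen l) p a} (K : ℝ)
    (h : ∀ (J : Fin (a + 1) → ↥D.s), ∀ y ∈ D.C a J l,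
      ‖(((g J : ↥(pqFormsOn E M (cechSet (D.U l) J) p 0)) : MForm 𝓘(ℝ, E) M ℂ (p + 0))).inChart (D.ctr a J) y‖ ≤ K) :
    Memℓp (D.rep p l a g) ⊤ := by
  refine memℓp_infty ⟨max K 0, ?_⟩
  rintro _ ⟨⟨J, y⟩, rfl⟩
  dsimp only
  by_cases hy : y ∈ D.C a J l
  · rw [D.rep_apply_of_mem p g hy]
    exact (h J y hy).trans (le_max_left _ _)
  · rw [D.rep_apply_of_notMem p g hy, norm_zero]
    exact le_max_right _ _

/-- **The Banach space of bounded holomorphic `a`-cochains of level `l`**: the holomorphic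
cochains whose representatives are bounded, i.e. lie in `ℓ^∞` (a structure, so that it carries the
sup norm and no other topology). [cite: GrauertRemmert1977, Kap. VI §4.1] -/
structure Bdd (l : Fin 4) (a : ℕ) where
  /-- the underlying holomorphic cochain -/
  val : CechHolForms E M (D.U l) (D.isOpen l) p a
  /-- its representatives are bounded -/
  memℓp : Memℓp (D.rep p l a val) ⊤

namespace Bdd

variable {D p} {l : Fin 4} {a : ℕ}

/-- Bounded cochains with the same underlying cochain are equal. [folklore] -/
@[ext] theorem ext {c c' : D.Bdd p l a} (h : c.val = c'.val) : c = c' := by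
  cases c; cases c'; congr

/-- The underlying-cochain map is injective. [folklore] -/
theorem val_injective : Injective (Bdd.val : D.Bdd p l a → CechHolForms E M (D.U l) (D.isOpen l) p a) :=
  fun _ _ h ↦ ext h

/-- The underlying cochain of an anonymous-constructor term. [folklore] -/
@[simp] theorem val_mk (g : CechHolForms E M (D.U l) (D.isOpen l) p a) (hg : Memℓp (D.rep p l a g) ⊤) :
    (⟨g, hg⟩ : D.Bdd p l a).val = g := rfl

/-- Structure instance transported from the underlying cochains. [folklore] -/
instance : Zero (D.Bdd p l a) := ⟨⟨0, by rw [map_zero]; exact zero_memℓp⟩⟩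
/-- Structure instance transported from the underlying cochains. [folklore] -/
instance : Add (D.Bdd p l a) := ⟨fun c c' ↦ ⟨c.val + c'.val, by rw [map_add]; exact c.memℓp.add c'.memℓp⟩⟩
/-- Structure instance transported from the underlying cochains. [folklore] -/
instance : SMul ℂ (D.Bdd p l a) := ⟨fun r c ↦ ⟨r • c.val, by rw [map_smul]; exact c.memℓp.const_smul r⟩⟩
/-- negation, through the complex scalar `-1` (so that boundedness is inherited) -/
instance : Neg (D.Bdd p l a) := ⟨fun c ↦ (-1 : ℂ) • c⟩
/-- subtraction, through negation -/
instance : Sub (D.Bdd p l a) := ⟨fun c c' ↦ c + -c'⟩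
/-- natural scalars, through the complex ones -/
instance : SMul ℕ (D.Bdd p l a) := ⟨fun n c ↦ (n : ℂ) • c⟩
/-- integer scalars, through the complex ones -/
instance : SMul ℤ (D.Bdd p l a) := ⟨fun n c ↦ (n : ℂ) • c⟩

/-- Underlying cochain of `0`. [folklore] -/
@[simp] theorem val_zero : (0 : D.Bdd p l a).val = 0 := rfl
/-- Underlying cochain of a sum. [folklore] -/
@[simp] theorem val_add (c c' : D.Bdd p l a) : (c + c').val = c.val + c'.val := rfl
/-- Underlying cochain of a complex multiple. [folklore] -/
@[simp] theorem val_smul (r : ℂ) (c : D.Bdd p l a) : (r • c).val = r • c.val := rfl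
/-- Underlying cochain of a negative. [folklore] -/
@[simp] theorem val_neg (c : D.Bdd p l a) : (-c).val = -c.val := neg_one_smul ℂ c.val
/-- Underlying cochain of a difference. [folklore] -/
@[simp] theorem val_sub (c c' : D.Bdd p l a) : (c - c').val = c.val - c'.val :=
  (congrArg (c.val + ·) (val_neg c')).trans (sub_eq_add_neg c.val c'.val).symm
/-- Underlying cochain of a natural multiple. [folklore] -/
theorem val_nsmul (c : D.Bdd p l a) (n : ℕ) : (n • c).val = n • c.val := Nat.cast_smul_eq_nsmul ℂ n c.val
/-- Underlying cochain of an integer multiple. [folklore] -/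
theorem val_zsmul (c : D.Bdd p l a) (n : ℤ) : (n • c).val = n • c.val := Int.cast_smul_eq_zsmul ℂ n c.val

/-- Structure instance transported from the underlying cochains. [folklore] -/
instance : AddCommGroup (D.Bdd p l a) :=
  val_injective.addCommGroup _ val_zero val_add val_neg val_sub val_nsmul val_zsmul

/-- The underlying cochain, as an additive homomorphism. [folklore] -/
def valHom : D.Bdd p l a →+ CechHolForms E M (D.U l) (D.isOpen l) p a where
  toFun := val
  map_zero' := rfl
  map_add' _ _ := rfl

/-- Structure instance transported from the underlying cochains. [folklore] -/
instance : Module ℂ (D.Bdd p l a) := val_injective.module ℂ valHom val_smul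

end Bdd

/-- **The isometric embedding into `ℓ^∞`** by the representatives. [cite: GrauertRemmert1977, Kap. VI §4.1] -/
def toLp (l : Fin 4) (a : ℕ) :
    D.Bdd p l a →ₗ[ℂ] ↥(lp (fun _ : (Fin (a + 1) → ↥D.s) × E ↦ E [⋀^Fin (p + 0)]→L[ℝ] ℂ) ⊤) where
  toFun c := ⟨D.rep p l a c.val, c.memℓp⟩
  map_add' c c' := by
    apply Subtype.ext
    change D.rep p l a (c.val + c'.val) = D.rep p l a c.val + D.rep p l a c'.val
    rw [map_add]
  map_smul' r c := by
    apply Subtype.ext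
    change D.rep p l a (r • c.val) = r • D.rep p l a c.val
    rw [map_smul]

/-- The embedding into `ℓ^∞`, evaluated. [folklore] -/
@[simp] theorem toLp_apply {l : Fin 4} {a : ℕ} (c : D.Bdd p l a) (i : (Fin (a + 1) → ↥D.s) × E) :
    (D.toLp p l a c : (Fin (a + 1) → ↥D.s) × E → E [⋀^Fin (p + 0)]→L[ℝ] ℂ) i = D.rep p l a c.val i := rfl

/-! ### The sup norm -/

/-- The representative of a restricted cochain on the smaller chart piece. [folklore] -/
theorem inChart_cechHolShrink {l l' : Fin 4} (h : l ≤ l') {a : ℕ} (g : CechHolForms E M (D.U l') (D.isOpen l') p a)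
    (J : Fin (a + 1) → ↥D.s) {y : E} (hy : y ∈ D.C a J l) :
    (((cechHolShrink E M (D.isOpen l') p (D.isOpen l) (D.mono l l' h) a g J :
        ↥(pqFormsOn E M (cechSet (D.U l) J) p 0)) : MForm 𝓘(ℝ, E) M ℂ (p + 0))).inChart (D.ctr a J) y =
      (((g J : ↥(pqFormsOn E M (cechSet (D.U l') J) p 0)) : MForm 𝓘(ℝ, E) M ℂ (p + 0))).inChart (D.ctr a J) y := by
  change ((holRestrict E M (isOpen_cechSet (D.isOpen l') J) (isOpen_cechSet (D.isOpen l) J)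
    (cechSet_mono (D.mono l l' h) J) p (g J) : ↥(pqFormsOn E M (cechSet (D.U l) J) p 0)) :
      MForm 𝓘(ℝ, E) M ℂ (p + 0)).inChart (D.ctr a J) y = _
  rw [coe_coe_holRestrict]
  exact inChart_restr_of_symm_mem _ (D.C_subset a J l hy) (D.symm_mem_cechSet hy)

/-- The representative of `δ g` at a point of `C_{l,J}`: the alternating sum of the
representatives of the faces in the SAME chart. [cite: BottTu1982Forms, §8 (8.4)] -/
theorem inChart_cechHolδ {l : Fin 4} {a : ℕ} (g : CechHolForms E M (D.U l) (D.isOpen l) p a)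
    (J : Fin (a + 2) → ↥D.s) {y : E} (hy : y ∈ D.C (a + 1) J l) :
    (((cechHolδ E M (D.isOpen l) p a g J : ↥(pqFormsOn E M (cechSet (D.U l) J) p 0)) :
        MForm 𝓘(ℝ, E) M ℂ (p + 0))).inChart (D.ctr (a + 1) J) y =
      ∑ j : Fin (a + 2), (-1 : ℂ) ^ (j : ℕ) •
        (((g (J ∘ Fin.succAbove j) : ↥(pqFormsOn E M (cechSet (D.U l) (J ∘ Fin.succAbove j)) p 0)) :
          MForm 𝓘(ℝ, E) M ℂ (p + 0))).inChart (D.ctr (a + 1) J) y := by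
  rw [D.coe_coe_cechHolδ, MForm.inChart_finset_sum, Finset.sum_apply]
  refine Finset.sum_congr rfl fun j _ ↦ ?_
  rw [MForm.inChart_smul_complex, Pi.smul_apply,
    inChart_restr_of_symm_mem _ (D.C_subset (a + 1) J l hy) (D.symm_mem_cechSet hy)]

/-- **A bounded cochain is determined by its representatives** (`eq_of_inChart_eqOn`). [folklore] -/
theorem toLp_injective (l : Fin 4) (a : ℕ) : Injective (D.toLp p l a) := by
  intro c c' h
  apply Bdd.ext
  funext J
  apply Subtype.ext
  apply Subtype.ext
  refine eq_of_inChart_eqOn (D.C_subset a J l) (D.coe_mem_pqFormsOn_chartSet p c.val J)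
    (D.coe_mem_pqFormsOn_chartSet p c'.val J) fun y hy ↦ ?_
  have h' := congrArg (fun f : ↥(lp (fun _ : (Fin (a + 1) → ↥D.s) × E ↦ E [⋀^Fin (p + 0)]→L[ℝ] ℂ) ⊤) ↦
    (f : (Fin (a + 1) → ↥D.s) × E → E [⋀^Fin (p + 0)]→L[ℝ] ℂ) (J, y)) h
  simp only [toLp_apply, D.rep_apply_of_mem p _ hy] at h'
  exact h'

/-- **The sup norm** `‖c‖ = sup_J sup_{C_{l,J}} ‖(c J)̂‖`, induced from `ℓ^∞` by the injective `toLp`.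
[cite: GrauertRemmert1977, Kap. VI §4.1] -/
instance (l : Fin 4) (a : ℕ) : NormedAddCommGroup (D.Bdd p l a) :=
  NormedAddCommGroup.induced (D.Bdd p l a)
    ↥(lp (fun _ : (Fin (a + 1) → ↥D.s) × E ↦ E [⋀^Fin (p + 0)]→L[ℝ] ℂ) ⊤) (D.toLp p l a) (D.toLp_injective p l a)

/-- The sup norm is a complex Banach-space norm. [cite: GrauertRemmert1977, Kap. VI §4.1] -/
instance (l : Fin 4) (a : ℕ) : NormedSpace ℂ (D.Bdd p l a) where
  norm_smul_le r c := by
    change ‖D.toLp p l a (r • c)‖ ≤ ‖r‖ * ‖D.toLp p l a c‖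
    rw [map_smul]
    exact norm_smul_le r _

/-- The norm is the `ℓ^∞` norm of the representatives. [folklore] -/
theorem norm_def {l : Fin 4} {a : ℕ} (c : D.Bdd p l a) : ‖c‖ = ‖D.toLp p l a c‖ := rfl

/-- **Each representative value is bounded by the norm.** [cite: GrauertRemmert1977, Kap. VI §4.1] -/
theorem norm_inChart_le {l : Fin 4} {a : ℕ} (c : D.Bdd p l a) {J : Fin (a + 1) → ↥D.s} {y : E}
    (hy : y ∈ D.C a J l) :
    ‖(((c.val J : ↥(pqFormsOn E M (cechSet (D.U l) J) p 0)) : MForm 𝓘(ℝ, E) M ℂ (p + 0))).inChart (D.ctr a J) y‖ ≤ ‖c‖ := by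
  have h := lp.norm_apply_le_norm ENNReal.top_ne_zero (D.toLp p l a c) (J, y)
  rwa [toLp_apply, D.rep_apply_of_mem p _ hy] at h

/-- **A uniform bound on the representatives bounds the norm.** [cite: GrauertRemmert1977, Kap. VI §4.1] -/
theorem norm_le_of_forall {l : Fin 4} {a : ℕ} (c : D.Bdd p l a) {K : ℝ} (hK : 0 ≤ K)
    (h : ∀ (J : Fin (a + 1) → ↥D.s), ∀ y ∈ D.C a J l,
      ‖(((c.val J : ↥(pqFormsOn E M (cechSet (D.U l) J) p 0)) : MForm 𝓘(ℝ, E) M ℂ (p + 0))).inChart (D.ctr a J) y‖ ≤ K) :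
    ‖c‖ ≤ K := by
  rw [norm_def]
  refine lp.norm_le_of_forall_le hK fun i ↦ ?_
  obtain ⟨J, y⟩ := i
  rw [toLp_apply]
  by_cases hy : y ∈ D.C a J l
  · rw [D.rep_apply_of_mem p _ hy]
    exact h J y hy
  · rw [D.rep_apply_of_notMem p _ hy, norm_zero]
    exact hK

/-! ### Restriction to a lower level -/

/-- Restriction of a bounded cochain to a lower level is bounded, with the pointwise identity of
representatives. [folklore] -/
theorem cechHolShrink_memℓp {l l' : Fin 4} (h : l ≤ l') {a : ℕ} (c : D.Bdd p l' a) :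
    Memℓp (D.rep p l a (cechHolShrink E M (D.isOpen l') p (D.isOpen l) (D.mono l l' h) a c.val)) ⊤ :=
  D.memℓp_of_forall p ‖c‖ fun J y hy ↦ by
    rw [D.inChart_cechHolShrink p h c.val J hy]
    exact D.norm_inChart_le p c (D.C_mono h a J hy)

/-- **Restriction of bounded holomorphic cochains to a lower level**, a contraction
`‖res c‖ ≤ ‖c‖` (same charts, smaller chart pieces). [cite: GrauertRemmert1977, Kap. VI §4.1] -/
def res {l l' : Fin 4} (h : l ≤ l') (a : ℕ) : D.Bdd p l' a →L[ℂ] D.Bdd p l a :=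
  LinearMap.mkContinuous
    { toFun := fun c ↦ ⟨_, D.cechHolShrink_memℓp p h c⟩
      map_add' := fun c c' ↦ Bdd.ext (map_add _ c.val c'.val)
      map_smul' := fun r c ↦ Bdd.ext (LinearMap.map_smul _ r c.val) }
    1 fun c ↦ by
      rw [one_mul]
      refine D.norm_le_of_forall p _ (norm_nonneg c) fun J y hy ↦ ?_
      change ‖(((cechHolShrink E M (D.isOpen l') p (D.isOpen l) (D.mono l l' h) a c.val J :
        ↥(pqFormsOn E M (cechSet (D.U l) J) p 0)) : MForm 𝓘(ℝ, E) M ℂ (p + 0))).inChart (D.ctr a J) y‖ ≤ ‖c‖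
      rw [D.inChart_cechHolShrink p h c.val J hy]
      exact D.norm_inChart_le p c (D.C_mono h a J hy)

/-- Underlying cochain of a restriction. [folklore] -/
@[simp] theorem val_res {l l' : Fin 4} (h : l ≤ l') {a : ℕ} (c : D.Bdd p l' a) :
    (D.res p h a c).val = cechHolShrink E M (D.isOpen l') p (D.isOpen l) (D.mono l l' h) a c.val := rfl

/-! ### The Čech differential is bounded below the top level -/

/-- **The Čech differential is bounded in the sup norms of level `l`, given a higher level `l'`**:
the faces are read in the chart of the face tuple, and the change-of-chart factors are bounded on
the compact `closure U_{l,J} ⊆ U_{l',J}` (Grauert–Remmert: "δ ist stetig").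
[cite: GrauertRemmert1977, Kap. VI §4.1] -/
theorem exists_delta_bound [CompactSpace M] {l l' : Fin 4} (h : l < l') (a : ℕ) :
    ∃ A : ℝ, 0 ≤ A ∧ ∀ (c : D.Bdd p l a) (J : Fin (a + 2) → ↥D.s), ∀ y ∈ D.C (a + 1) J l,
      ‖(((cechHolδ E M (D.isOpen l) p a c.val J : ↥(pqFormsOn E M (cechSet (D.U l) J) p 0)) :
        MForm 𝓘(ℝ, E) M ℂ (p + 0))).inChart (D.ctr (a + 1) J) y‖ ≤ A * ‖c‖ := by
  have hK : ∀ J : Fin (a + 2) → ↥D.s, IsCompact (closure (cechSet (D.U l) J)) := fun J ↦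
    isClosed_closure.isCompact
  have h0 : ∀ J : Fin (a + 2) → ↥D.s, closure (cechSet (D.U l) J) ⊆ (extChartAt 𝓘(ℝ, E) (D.ctr (a + 1) J)).source :=
    fun J ↦ (D.closure_subset l l' h _ J).trans (D.cechSet_subset_source l' J)
  have h1 : ∀ (J : Fin (a + 2) → ↥D.s) (j : Fin (a + 2)),
      closure (cechSet (D.U l) J) ⊆ (extChartAt 𝓘(ℝ, E) (D.ctr a (J ∘ Fin.succAbove j))).source := fun J j ↦
    (D.closure_subset l l' h _ J).trans ((cechSet_subset_comp (D.U l') J (Fin.succAbove j)).trans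
      (D.cechSet_subset_source l' _))
  choose A hA0 hA using fun (J : Fin (a + 2) → ↥D.s) (j : Fin (a + 2)) ↦
    exists_norm_inChart_le_of_isCompact (hK J) (h0 J) (h1 J j) (p + 0)
  refine ⟨∑ J, ∑ j, A J j, Finset.sum_nonneg fun J _ ↦ Finset.sum_nonneg fun j _ ↦ hA0 J j, fun c J y hy ↦ ?_⟩
  set m := (extChartAt 𝓘(ℝ, E) (D.ctr (a + 1) J)).symm y with hm
  have hmU : m ∈ cechSet (D.U l) J := D.symm_mem_cechSet hy
  have hym : extChartAt 𝓘(ℝ, E) (D.ctr (a + 1) J) m = y := (extChartAt 𝓘(ℝ, E) _).right_inv (D.C_subset _ J l hy)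
  rw [D.inChart_cechHolδ p c.val J hy]
  calc ‖∑ j : Fin (a + 2), (-1 : ℂ) ^ (j : ℕ) •
        (((c.val (J ∘ Fin.succAbove j) : ↥(pqFormsOn E M (cechSet (D.U l) (J ∘ Fin.succAbove j)) p 0)) :
          MForm 𝓘(ℝ, E) M ℂ (p + 0))).inChart (D.ctr (a + 1) J) y‖
      ≤ ∑ j : Fin (a + 2), ‖(-1 : ℂ) ^ (j : ℕ) •
        (((c.val (J ∘ Fin.succAbove j) : ↥(pqFormsOn E M (cechSet (D.U l) (J ∘ Fin.succAbove j)) p 0)) :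
          MForm 𝓘(ℝ, E) M ℂ (p + 0))).inChart (D.ctr (a + 1) J) y‖ := norm_sum_le _ _
    _ ≤ ∑ j : Fin (a + 2), A J j * ‖c‖ := Finset.sum_le_sum fun j _ ↦ by
        rw [norm_smul, norm_pow, norm_neg, norm_one, one_pow, one_mul, ← hym]
        refine (hA J j _ m (subset_closure hmU)).trans (mul_le_mul_of_nonneg_left ?_ (hA0 J j))
        exact D.norm_inChart_le p c (D.extChartAt_mem_C (cechSet_subset_comp (D.U l) J (Fin.succAbove j) hmU))
    _ = (∑ j : Fin (a + 2), A J j) * ‖c‖ := (Finset.sum_mul _ _ _).symm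
    _ ≤ (∑ J, ∑ j, A J j) * ‖c‖ := mul_le_mul_of_nonneg_right
        (Finset.single_le_sum (f := fun J ↦ ∑ j, A J j) (fun J _ ↦ Finset.sum_nonneg fun j _ ↦ hA0 J j)
          (Finset.mem_univ J)) (norm_nonneg _)

/-- **The Čech differential on bounded holomorphic cochains** of a level `l` below a level `l'`,
a bounded operator `C^a_b(𝔘_l, Ω^p) → C^{a+1}_b(𝔘_l, Ω^p)`. [cite: GrauertRemmert1977, Kap. VI §4.1] -/
def delta [CompactSpace M] {l l' : Fin 4} (h : l < l') (a : ℕ) : D.Bdd p l a →L[ℂ] D.Bdd p l (a + 1) :=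
  LinearMap.mkContinuousOfExistsBound
    { toFun := fun c ↦ ⟨cechHolδ E M (D.isOpen l) p a c.val,
        (D.exists_delta_bound p h a).elim fun _ hA ↦ D.memℓp_of_forall p _ fun J y hy ↦ hA.2 c J y hy⟩
      map_add' := fun c c' ↦ Bdd.ext (map_add _ c.val c'.val)
      map_smul' := fun r c ↦ Bdd.ext (LinearMap.map_smul _ r c.val) }
    ((D.exists_delta_bound p h a).imp fun _ hA c ↦
      D.norm_le_of_forall p _ (mul_nonneg hA.1 (norm_nonneg _)) fun J y hy ↦ hA.2 c J y hy)

/-- Underlying cochain of a Čech differential. [folklore] -/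
@[simp] theorem val_delta [CompactSpace M] {l l' : Fin 4} (h : l < l') {a : ℕ} (c : D.Bdd p l a) :
    (D.delta p h a c).val = cechHolδ E M (D.isOpen l) p a c.val := rfl

/-! ### Holomorphic representatives -/

/-- The representatives of a holomorphic cochain have values of type `(p,0)` on the chart pieces.
[cite: VoisinHodgeI2002, §2.3.1] -/
theorem isOfTypeAt_rep {l : Fin 4} {a : ℕ} (g : CechHolForms E M (D.U l) (D.isOpen l) p a)
    (J : Fin (a + 1) → ↥D.s) {y : E} (hy : y ∈ D.C a J l) :
    IsOfTypeAt p 0 ((((g J : ↥(pqFormsOn E M (cechSet (D.U l) J) p 0)) : MForm 𝓘(ℝ, E) M ℂ (p + 0)).inChart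
      (D.ctr a J)) y) :=
  isOfTypeAt_inChart (D.C_subset a J l) (D.C_open a J l) (D.coe_mem_pqFormsOn_chartSet p g J) hy

/-- **A holomorphic `F : C_{l,J} → Λ^{p,0}` defines a holomorphic `p`-form on `U_{l,J}`.**
[cite: HuybrechtsCG2005, Prop. 2.6.11] -/
def ofRep (l : Fin 4) (a : ℕ) (J : Fin (a + 1) → ↥D.s) (F : E → E [⋀^Fin (p + 0)]→L[ℝ] ℂ)
    (hF : DifferentiableOn ℂ F (D.C a J l)) (ht : ∀ y ∈ D.C a J l, IsOfTypeAt p 0 (F y)) :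
    ↥(holFormsOn E M (isOpen_cechSet (D.isOpen l) J) p) :=
  ⟨⟨MForm.ofChartOn (D.ctr a J) (cechSet (D.U l) J) F,
    (exists_mem_holFormsOn_ofChartOn (isOpen_cechSet (D.isOpen l) J) (D.cechSet_eq a J l) (D.C_subset a J l)
      (D.C_open a J l) hF ht).fst⟩,
    (exists_mem_holFormsOn_ofChartOn (isOpen_cechSet (D.isOpen l) J) (D.cechSet_eq a J l) (D.C_subset a J l)
      (D.C_open a J l) hF ht).snd⟩

/-- The representative of `ofRep F` on `C_{l,J}` is `F`. [folklore] -/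
theorem inChart_ofRep {l : Fin 4} {a : ℕ} {J : Fin (a + 1) → ↥D.s} {F : E → E [⋀^Fin (p + 0)]→L[ℝ] ℂ}
    (hF : DifferentiableOn ℂ F (D.C a J l)) (ht : ∀ y ∈ D.C a J l, IsOfTypeAt p 0 (F y)) {y : E}
    (hy : y ∈ D.C a J l) :
    (((D.ofRep p l a J F hF ht : ↥(pqFormsOn E M (cechSet (D.U l) J) p 0)) : MForm 𝓘(ℝ, E) M ℂ (p + 0))).inChart
      (D.ctr a J) y = F y := by
  change (MForm.ofChartOn (D.ctr a J) (cechSet (D.U l) J) F : MForm 𝓘(ℝ, E) M ℂ (p + 0)).inChart (D.ctr a J) y = F y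
  rw [D.cechSet_eq a J l]
  exact MForm.inChart_ofChartOn (D.C_subset a J l) F hy

/-- **The representatives of a holomorphic cochain are holomorphic on the chart pieces.**
[cite: HuybrechtsCG2005, Prop. 2.6.11] -/
theorem differentiableOn_rep {l : Fin 4} {a : ℕ} (g : CechHolForms E M (D.U l) (D.isOpen l) p a)
    (J : Fin (a + 1) → ↥D.s) :
    DifferentiableOn ℂ (((g J : ↥(pqFormsOn E M (cechSet (D.U l) J) p 0)) : MForm 𝓘(ℝ, E) M ℂ (p + 0)).inChart
      (D.ctr a J)) (D.C a J l) :=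
  differentiableOn_inChart_of_mem_holFormsOn (isOpen_cechSet (D.isOpen l) J) (D.cechSet_eq a J l)
    (D.C_subset a J l) (D.C_open a J l) (g J : ↥(pqFormsOn E M (cechSet (D.U l) J) p 0)) (g J).2

/-! ### Completeness -/

/-- **The range of the embedding into `ℓ^∞` is closed**: a uniform limit of representatives of
holomorphic cochains is, on each chart piece, holomorphic (Weierstrass in several variables) with
values of type `(p,0)` (a closed condition), hence the representative of a holomorphic cochain.
[cite: GrauertRemmert1977, Kap. V §6.4] -/
theorem isClosed_range_toLp (l : Fin 4) (a : ℕ) : IsClosed (range (D.toLp p l a)) := by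
  refine isSeqClosed_iff_isClosed.1 fun u f hu huf ↦ ?_
  choose c hc using hu
  -- uniform convergence of the representatives on the chart pieces
  have hunif : ∀ J : Fin (a + 1) → ↥D.s, TendstoUniformlyOn
      (fun n y ↦ ((((c n).val J : ↥(pqFormsOn E M (cechSet (D.U l) J) p 0)) : MForm 𝓘(ℝ, E) M ℂ (p + 0))).inChart
        (D.ctr a J) y)
      (fun y ↦ (f : (Fin (a + 1) → ↥D.s) × E → E [⋀^Fin (p + 0)]→L[ℝ] ℂ) (J, y)) atTop (D.C a J l) := by
    intro J
    refine Metric.tendstoUniformlyOn_iff.2 fun ε hε ↦ ?_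
    obtain ⟨N, hN⟩ := Metric.tendsto_atTop.1 huf ε hε
    refine eventually_atTop.2 ⟨N, fun n hn y hy ↦ ?_⟩
    have h1 := lp.norm_apply_le_norm ENNReal.top_ne_zero (f - u n) (J, y)
    rw [← hc n, lp.coeFn_sub, Pi.sub_apply, toLp_apply, D.rep_apply_of_mem p _ hy] at h1
    rw [dist_eq_norm]
    refine h1.trans_lt ?_
    rw [← dist_eq_norm, hc n, dist_comm]
    exact hN n hn
  have hdiff : ∀ J : Fin (a + 1) → ↥D.s, DifferentiableOn ℂ
      (fun y ↦ (f : (Fin (a + 1) → ↥D.s) × E → E [⋀^Fin (p + 0)]→L[ℝ] ℂ) (J, y)) (D.C a J l) := fun J ↦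
    SCV.differentiableOn_of_tendstoLocallyUniformlyOn (D.C_open a J l) (fun n ↦ D.differentiableOn_rep p (c n).val J)
      (hunif J).tendstoLocallyUniformlyOn
  have htype : ∀ J : Fin (a + 1) → ↥D.s, ∀ y ∈ D.C a J l,
      IsOfTypeAt p 0 ((f : (Fin (a + 1) → ↥D.s) × E → E [⋀^Fin (p + 0)]→L[ℝ] ℂ) (J, y)) := fun J y hy ↦
    isOfTypeAt_of_mem_typeSubmodule rfl ((isClosed_typeSubmodule (E := E) (k := p + 0) p 0).mem_of_tendsto
      ((hunif J).tendsto_at hy) (Eventually.of_forall fun n ↦ (D.isOfTypeAt_rep p (c n).val J hy).mem_typeSubmodule))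
  -- the limit cochain
  have hg : Memℓp (D.rep p l a fun J ↦ D.ofRep p l a J _ (hdiff J) (htype J)) ⊤ :=
    D.memℓp_of_forall p ‖f‖ fun J y hy ↦ by
      rw [D.inChart_ofRep p (hdiff J) (htype J) hy]
      exact lp.norm_apply_le_norm ENNReal.top_ne_zero f (J, y)
  refine ⟨⟨_, hg⟩, ?_⟩
  apply Subtype.ext
  funext ⟨J, y⟩
  change D.rep p l a (fun J ↦ D.ofRep p l a J _ (hdiff J) (htype J)) (J, y) = _
  by_cases hy : y ∈ D.C a J l
  · rw [D.rep_apply_of_mem p _ hy]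
    exact D.inChart_ofRep p (hdiff J) (htype J) hy
  · rw [D.rep_apply_of_notMem p _ hy]
    -- `f (J, y)` is the limit of `u n (J, y) = 0`
    have hpt : Tendsto (fun n ↦ (u n : (Fin (a + 1) → ↥D.s) × E → E [⋀^Fin (p + 0)]→L[ℝ] ℂ) (J, y)) atTop
        (𝓝 ((f : (Fin (a + 1) → ↥D.s) × E → E [⋀^Fin (p + 0)]→L[ℝ] ℂ) (J, y))) := by
      refine Metric.tendsto_atTop.2 fun ε hε ↦ ?_
      obtain ⟨N, hN⟩ := Metric.tendsto_atTop.1 huf ε hε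
      refine ⟨N, fun n hn ↦ ?_⟩
      have h1 := lp.norm_apply_le_norm ENNReal.top_ne_zero (u n - f) (J, y)
      rw [lp.coeFn_sub, Pi.sub_apply] at h1
      rw [dist_eq_norm]
      exact h1.trans_lt (by rw [← dist_eq_norm]; exact hN n hn)
    have h0 : ∀ n, (u n : (Fin (a + 1) → ↥D.s) × E → E [⋀^Fin (p + 0)]→L[ℝ] ℂ) (J, y) = 0 := fun n ↦ by
      rw [← hc n, toLp_apply, D.rep_apply_of_notMem p _ hy]
    simp only [h0] at hpt
    exact tendsto_nhds_unique tendsto_const_nhds hpt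

/-- **The bounded holomorphic cochains form a Banach space.** [cite: GrauertRemmert1977, Kap. VI §4.1] -/
instance instCompleteSpace (l : Fin 4) (a : ℕ) : CompleteSpace (D.Bdd p l a) := by
  have hiso : Isometry (D.toLp p l a) := fun _ _ ↦ rfl
  rw [completeSpace_iff_isComplete_range hiso.isUniformInducing]
  exact (D.isClosed_range_toLp p l a).isComplete

/-! ### Restriction to a strictly lower level is compact (Montel) -/

/-- **Montel extraction for restriction**: a bounded sequence of bounded holomorphic cochains of
level `l'` has a subsequence whose restrictions to a level `l < l'` converge (Montel's theorem for
the representatives, holomorphic and uniformly bounded on the `C_{l',J}`, uniformly on the compact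
sets `e_J(closure U_{l,J}) ⊇ C_{l,J}`; the limits are holomorphic of type `(p,0)` and define the
limit cochain). Grauert–Remmert (1977), Kap. VI §2.4 (Satz 4) / §4.2.
[cite: GrauertRemmert1977, Kap. VI §4.2] -/
theorem exists_subseq_tendsto_res [CompactSpace M] {l l' : Fin 4} (h : l < l') (a : ℕ)
    (u : ℕ → D.Bdd p l' a) (hu : ∀ n, ‖u n‖ ≤ 1) :
    ∃ (c : D.Bdd p l a) (φ : ℕ → ℕ), StrictMono φ ∧ Tendsto (fun n ↦ D.res p h.le a (u (φ n))) atTop (𝓝 c) := by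
  haveI : FiniteDimensional ℝ (E [⋀^Fin (p + 0)]→L[ℝ] ℂ) := ChartOp1.finiteDimensional_continuousAlternatingMap
  haveI : ProperSpace (E [⋀^Fin (p + 0)]→L[ℝ] ℂ) := FiniteDimensional.proper_real _
  obtain ⟨g, φ, hφ, hg⟩ := exists_strictMono_tendstoUniformlyOn_finset Finset.univ (fun J ↦ D.C_open a J l')
    (fun J ↦ D.isCompact_image_closure h J) (fun J ↦ D.image_closure_subset_C h J)
    (f := fun n J ↦ ((((u n).val J : ↥(pqFormsOn E M (cechSet (D.U l') J) p 0)) : MForm 𝓘(ℝ, E) M ℂ (p + 0))).inChart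
      (D.ctr a J)) (Mb := 1)
    (fun n J ↦ D.differentiableOn_rep p (u n).val J) (fun n J z hz ↦ (D.norm_inChart_le p (u n) hz).trans (hu n))
  have hdiff : ∀ J, DifferentiableOn ℂ (g J) (D.C a J l) := fun J ↦ (hg J (Finset.mem_univ J)).1.mono (D.C_mono h.le a J)
  have htype : ∀ J, ∀ y ∈ D.C a J l, IsOfTypeAt p 0 (g J y) := fun J y hy ↦
    isOfTypeAt_of_mem_typeSubmodule rfl ((isClosed_typeSubmodule (E := E) (k := p + 0) p 0).mem_of_tendsto
      ((hg J (Finset.mem_univ J)).2.2.tendsto_at (D.C_subset_image_closure l J hy))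
      (Eventually.of_forall fun n ↦ (D.isOfTypeAt_rep p (u (φ n)).val J (D.C_mono h.le a J hy)).mem_typeSubmodule))
  have hc : Memℓp (D.rep p l a fun J ↦ D.ofRep p l a J (g J) (hdiff J) (htype J)) ⊤ :=
    D.memℓp_of_forall p 1 fun J y hy ↦ by
      rw [D.inChart_ofRep p (hdiff J) (htype J) hy]
      exact (hg J (Finset.mem_univ J)).2.1 y (D.C_mono h.le a J hy)
  refine ⟨⟨_, hc⟩, φ, hφ, Metric.tendsto_atTop.2 fun ε hε ↦ ?_⟩
  have hev : ∀ᶠ n in atTop, ∀ J : Fin (a + 1) → ↥D.s, ∀ y ∈ extChartAt 𝓘(ℝ, E) (D.ctr a J) '' closure (cechSet (D.U l) J),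
      dist (g J y) (((((u (φ n)).val J : ↥(pqFormsOn E M (cechSet (D.U l') J) p 0)) :
        MForm 𝓘(ℝ, E) M ℂ (p + 0))).inChart (D.ctr a J) y) < ε / 2 :=
    eventually_all.2 fun J ↦ Metric.tendstoUniformlyOn_iff.1 (hg J (Finset.mem_univ J)).2.2 (ε / 2) (half_pos hε)
  obtain ⟨N, hN⟩ := eventually_atTop.1 hev
  refine ⟨N, fun n hn ↦ ?_⟩
  rw [dist_eq_norm]
  refine (D.norm_le_of_forall p _ (half_pos hε).le fun J y hy ↦ ?_).trans_lt (half_lt_self hε)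
  rw [Bdd.val_sub, Pi.sub_apply, Submodule.coe_sub, Submodule.coe_sub, inChart_sub', Pi.sub_apply, val_res,
    D.inChart_cechHolShrink p h.le _ J hy, Bdd.val_mk, D.inChart_ofRep p (hdiff J) (htype J) hy, ← dist_eq_norm,
    dist_comm]
  exact (hN n hn J y (D.C_subset_image_closure l J hy)).le

/-- **Restriction of bounded holomorphic cochains to a strictly lower level is a compact operator**
(Montel; Grauert–Remmert (1977), Kap. VI, Satz 4.1 "vollstetig"). [cite: GrauertRemmert1977, Kap. VI §4.2] -/
theorem isCompactOperator_res [CompactSpace M] {l l' : Fin 4} (h : l < l') (a : ℕ) :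
    IsCompactOperator (D.res p h.le a) :=
  isCompactOperator_of_subseq _ (D.exists_subseq_tendsto_res p h a)

end Spaces

section Leray

variable [FiniteDimensional ℂ E] [T2Space M] [CompactSpace M] [IsManifold 𝓘(ℂ, E) ω M] [IsManifold 𝓘(ℝ, E) ∞ M]
  (p : ℕ)

/-! ### Leray: every level computes the Dolbeault cohomology -/

omit [CompactSpace M] in
/-- Transport of `∂̄`-acyclicity along an identification of an open set with a convex chart set.
[cite: VoisinHodgeI2002, Prop. 2.36] -/
theorem _root_.Literature.Geometry.Kaehler.IsDolbeaultAcyclic.of_eq_chartSet {W : Set M} (hW : IsOpen W)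
    {x₀ : M} {C : Set E} (hWC : W = chartSet 𝓘(ℝ, E) x₀ C) (hC : IsOpen C) (hCc : Convex ℝ C)
    (hCt : C ⊆ (extChartAt 𝓘(ℝ, E) x₀).target) : IsDolbeaultAcyclic E M hW p := by
  subst hWC
  exact isDolbeaultAcyclic_chartSet x₀ hC hCc (by rwa [← extChartAt_target_eq_chartAt_target]) p

omit [CompactSpace M] in
/-- **All finite intersections of all levels are `∂̄`-acyclic** (they are convex chart sets:
`isDolbeaultAcyclic_chartSet`, the `∂̄`-Poincaré lemma). [cite: VoisinHodgeI2002, Prop. 2.36] -/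
theorem isDolbeaultAcyclic_cechSet (l : Fin 4) (a : ℕ) (J : Fin (a + 1) → ↥D.s) :
    IsDolbeaultAcyclic E M (isOpen_cechSet (D.isOpen l) J) p :=
  IsDolbeaultAcyclic.of_eq_chartSet p _ (D.cechSet_eq a J l) (D.C_open a J l) (D.C_convex a J l) (D.C_subset a J l)

/-- **The Leray isomorphism of level `l`**: `H^q(A^{p,•}(M), ∂̄) ≃ H^q(𝔘_l, Ω^p)`
(`cechDolbeaultEquiv` for the acyclic finite cover `𝔘_l`). [cite: GrauertRemmert1977, Kap. VI Einleitung] -/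
def leray (l : Fin 4) (q : ℕ) :
    NatCochain.Cohomology (R := ℂ) (fun b ↦ localDbar E M (isOpen_univ : IsOpen (univ : Set M)) p b) q ≃ₗ[ℂ]
      NatCochain.Cohomology (R := ℂ) (A := CechHolForms E M (D.U l) (D.isOpen l) p) (cechHolδ E M (D.isOpen l) p) q :=
  cechDolbeaultEquiv E M (D.isOpen l) p (D.cover l) (D.isDolbeaultAcyclic_cechSet p l) q

/-- **Naturality of the Leray isomorphisms under restriction of the level** (`l ≤ l'`):
`leray l = H^q(res_{l' → l}) ∘ leray l'`. [cite: GrauertRemmert1977, Kap. VI Einleitung] -/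
theorem leray_natural {l l' : Fin 4} (h : l ≤ l') (q : ℕ)
    (c : NatCochain.Cohomology (R := ℂ) (fun b ↦ localDbar E M (isOpen_univ : IsOpen (univ : Set M)) p b) q) :
    D.leray p l q c =
      NatCochain.Cohomology.map (R := ℂ) (A := CechHolForms E M (D.U l') (D.isOpen l') p)
        (A' := CechHolForms E M (D.U l) (D.isOpen l) p)
        (cechHolShrink E M (D.isOpen l') p (D.isOpen l) (D.mono l l' h))
        (cechHolShrink_cechHolδ (D.isOpen l') p (D.isOpen l) (D.mono l l' h)) q (D.leray p l' q c) :=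
  cechDolbeaultEquiv_natural (D.isOpen l') p (D.isOpen l) (D.mono l l' h) (D.cover l') (D.cover l)
    (D.isDolbeaultAcyclic_cechSet p l') (D.isDolbeaultAcyclic_cechSet p l) q c

/-! ### Bounded cocycles and the restricted operators -/

/-- **The bounded cocycles of level `l`**: the kernel of the bounded Čech differential (the higher
level `l'` only witnesses boundedness of `δ`). [cite: GrauertRemmert1977, Kap. VI §4.3] -/
def Zb {l l' : Fin 4} (h : l < l') (a : ℕ) : Submodule ℂ (D.Bdd p l a) :=
  LinearMap.ker (D.delta p h a).toLinearMap

/-- Membership in the bounded cocycles. [folklore] -/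
theorem mem_Zb_iff {l l' : Fin 4} {h : l < l'} {a : ℕ} {c : D.Bdd p l a} :
    c ∈ D.Zb p h a ↔ cechHolδ E M (D.isOpen l) p a c.val = 0 := by
  rw [Zb, LinearMap.mem_ker]
  constructor
  · intro hc
    have h' := congrArg Bdd.val hc
    rwa [ContinuousLinearMap.coe_coe, val_delta, Bdd.val_zero] at h'
  · intro hc
    apply Bdd.ext
    rw [ContinuousLinearMap.coe_coe, val_delta, Bdd.val_zero]
    exact hc

/-- The bounded cocycles form a closed subspace. [folklore] -/
theorem isClosed_Zb {l l' : Fin 4} (h : l < l') (a : ℕ) : IsClosed (D.Zb p h a : Set (D.Bdd p l a)) :=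
  (D.delta p h a).isClosed_ker

/-- The bounded cocycles form a Banach space. [cite: GrauertRemmert1977, Kap. VI §4.3] -/
instance instCompleteSpaceZb {l l' : Fin 4} (h : l < l') (a : ℕ) : CompleteSpace ↥(D.Zb p h a) :=
  (D.isClosed_Zb p h a).completeSpace_coe

/-- **Restriction of bounded cocycles to a lower level.** [cite: GrauertRemmert1977, Kap. VI §4.3] -/
def resZ {l l' l'' : Fin 4} (h : l < l') (h' : l' < l'') (a : ℕ) : ↥(D.Zb p h' a) →L[ℂ] ↥(D.Zb p h a) :=
  ((D.res p h.le a).comp (D.Zb p h' a).subtypeL).codRestrict (D.Zb p h a) fun x ↦ by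
    rw [mem_Zb_iff]
    change cechHolδ E M (D.isOpen l) p a
      (cechHolShrink E M (D.isOpen l') p (D.isOpen l) (D.mono l l' h.le) a (x : D.Bdd p l' a).val) = 0
    rw [← cechHolShrink_cechHolδ, (D.mem_Zb_iff p).1 x.2, map_zero]

/-- Restriction of bounded cocycles on underlying bounded cochains. [folklore] -/
@[simp] theorem coe_resZ {l l' l'' : Fin 4} (h : l < l') (h' : l' < l'') {a : ℕ} (x : ↥(D.Zb p h' a)) :
    ((D.resZ p h h' a x : ↥(D.Zb p h a)) : D.Bdd p l a) = D.res p h.le a (x : D.Bdd p l' a) := rfl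

/-- **The bounded Čech differential into the bounded cocycles** (`δ ∘ δ = 0`).
[cite: GrauertRemmert1977, Kap. VI §4.3] -/
def deltaZ {l l' : Fin 4} (h : l < l') (k : ℕ) : D.Bdd p l k →L[ℂ] ↥(D.Zb p h (k + 1)) :=
  (D.delta p h k).codRestrict (D.Zb p h (k + 1)) fun c ↦ by
    rw [mem_Zb_iff, val_delta]
    exact D.cechHolδ_cechHolδ p c.val

/-- The Čech differential into cocycles on underlying bounded cochains. [folklore] -/
@[simp] theorem coe_deltaZ {l l' : Fin 4} (h : l < l') {k : ℕ} (w : D.Bdd p l k) :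
    ((D.deltaZ p h k w : ↥(D.Zb p h (k + 1))) : D.Bdd p l (k + 1)) = D.delta p h k w := rfl

/-- **Restriction of bounded cocycles to a strictly lower level is compact** (Montel, and the
cocycles are closed). [cite: GrauertRemmert1977, Kap. VI §4.2] -/
theorem isCompactOperator_resZ {l l' l'' : Fin 4} (h : l < l') (h' : l' < l'') (a : ℕ) :
    IsCompactOperator (D.resZ p h h' a) := by
  refine isCompactOperator_of_subseq _ fun u hu ↦ ?_
  obtain ⟨c, φ, hφ, hc⟩ := D.exists_subseq_tendsto_res p h a (fun n ↦ (u n : D.Bdd p l' a)) fun n ↦ hu n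
  have hcZ : c ∈ D.Zb p h a :=
    (D.isClosed_Zb p h a).mem_of_tendsto hc (Eventually.of_forall fun n ↦ (D.resZ p h h' a (u (φ n))).2)
  exact ⟨⟨c, hcZ⟩, φ, hφ, tendsto_subtype_rng.2 hc⟩

/-- **Algebraic restriction to a strictly lower level is bounded**: the representatives of a
holomorphic cochain of level `l'` are continuous on `C_{l',J} ⊇ e_J(closure U_{l,J}) ⊇ C_{l,J}`,
hence bounded on `C_{l,J}`. [cite: GrauertRemmert1977, Kap. VI §4.3] -/
theorem memℓp_cechHolShrink_of_lt {l l' : Fin 4} (h : l < l') (a : ℕ)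
    (g : CechHolForms E M (D.U l') (D.isOpen l') p a) :
    Memℓp (D.rep p l a (cechHolShrink E M (D.isOpen l') p (D.isOpen l) (D.mono l l' h.le) a g)) ⊤ := by
  have hB : ∀ J : Fin (a + 1) → ↥D.s, ∃ B : ℝ, ∀ y ∈ extChartAt 𝓘(ℝ, E) (D.ctr a J) '' closure (cechSet (D.U l) J),
      ‖(((g J : ↥(pqFormsOn E M (cechSet (D.U l') J) p 0)) : MForm 𝓘(ℝ, E) M ℂ (p + 0))).inChart (D.ctr a J) y‖ ≤ B :=
    fun J ↦ (D.isCompact_image_closure h J).exists_bound_of_continuousOn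
      (((contDiffOn_inChart_of_mem_smoothFormsOn (D.C_subset a J l')
        (mem_smoothFormsOn_of_mem_pqFormsOn (D.coe_mem_pqFormsOn_chartSet p g J))).continuousOn).mono
        (D.image_closure_subset_C h J))
  choose B hB using hB
  refine D.memℓp_of_forall p (∑ J, max (B J) 0) fun J y hy ↦ ?_
  rw [D.inChart_cechHolShrink p h.le g J hy]
  exact ((hB J y (D.C_subset_image_closure l J hy)).trans (le_max_left _ _)).trans
    (Finset.single_le_sum (f := fun J ↦ max (B J) 0) (fun J _ ↦ le_max_right _ _) (Finset.mem_univ J))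

/-- A bounded cocycle as an algebraic cocycle. [folklore] -/
def toCocycle {l l' : Fin 4} (h : l < l') (q : ℕ) :
    ↥(D.Zb p h q) →ₗ[ℂ]
      ↥(NatCochain.cocycles (R := ℂ) (A := CechHolForms E M (D.U l) (D.isOpen l) p) (cechHolδ E M (D.isOpen l) p) q) where
  toFun y := ⟨(y : D.Bdd p l q).val, (NatCochain.mem_cocycles_iff _).2 ((D.mem_Zb_iff p).1 y.2)⟩
  map_add' _ _ := rfl
  map_smul' _ _ := rfl

/-- Underlying cochain of the algebraic cocycle of a bounded cocycle. [folklore] -/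
@[simp] theorem coe_toCocycle {l l' : Fin 4} (h : l < l') {q : ℕ} (y : ↥(D.Zb p h q)) :
    (D.toCocycle p h q y : CechHolForms E M (D.U l) (D.isOpen l) p q) = (y : D.Bdd p l q).val := rfl

/-- **The Dolbeault class of a bounded cocycle** (through the Leray isomorphism of its level).
[cite: GrauertRemmert1977, Kap. VI §4.3] -/
def cls {l l' : Fin 4} (h : l < l') (q : ℕ) :
    ↥(D.Zb p h q) →ₗ[ℂ] NatCochain.Cohomology (R := ℂ) (fun b ↦ localDbar E M (isOpen_univ : IsOpen (univ : Set M)) p b) q :=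
  (D.leray p l q).symm.toLinearMap ∘ₗ (NatCochain.Cohomology.mk _ q) ∘ₗ D.toCocycle p h q

/-- The class map, unfolded. [folklore] -/
theorem cls_apply {l l' : Fin 4} (h : l < l') {q : ℕ} (y : ↥(D.Zb p h q)) :
    D.cls p h q y = (D.leray p l q).symm (NatCochain.Cohomology.mk _ q (D.toCocycle p h q y)) := rfl

/-- **Coboundaries of bounded cochains have zero class.** [cite: GrauertRemmert1977, Kap. VI §4.3] -/
theorem cls_deltaZ {l l' : Fin 4} (h : l < l') (k : ℕ) (w : D.Bdd p l k) :
    D.cls p h (k + 1) (D.deltaZ p h k w) = 0 := by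
  rw [cls_apply, LinearEquiv.map_eq_zero_iff, NatCochain.Cohomology.mk_eq_zero_iff,
    NatCochain.mem_coboundaries_succ_iff]
  exact ⟨w.val, rfl⟩

set_option maxHeartbeats 800000 in
/-- **Every Dolbeault class is the class of a bounded cocycle restricted from one level up**
(Leray at level `l₂`, then restrict the representing cocycle: restriction to a strictly lower
level is bounded). [cite: GrauertRemmert1977, Kap. VI §4.3] -/
theorem exists_cls_resZ_eq {l₀ l₁ l₂ : Fin 4} (h₀₁ : l₀ < l₁) (h₁₂ : l₁ < l₂) (q : ℕ)
    (c : NatCochain.Cohomology (R := ℂ) (fun b ↦ localDbar E M (isOpen_univ : IsOpen (univ : Set M)) p b) q) :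
    ∃ y : ↥(D.Zb p h₁₂ q), D.cls p h₀₁ q (D.resZ p h₀₁ h₁₂ q y) = c := by
  obtain ⟨z, hz⟩ := NatCochain.Cohomology.mk_surjective _ q (D.leray p l₂ q c)
  have hzδ : cechHolδ E M (D.isOpen l₂) p q (z : CechHolForms E M (D.U l₂) (D.isOpen l₂) p q) = 0 :=
    (NatCochain.mem_cocycles_iff _).1 z.2
  have hy : (⟨_, D.memℓp_cechHolShrink_of_lt p h₁₂ q z⟩ : D.Bdd p l₁ q) ∈ D.Zb p h₁₂ q := by
    rw [mem_Zb_iff, Bdd.val_mk, ← cechHolShrink_cechHolδ, hzδ, map_zero]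
  refine ⟨⟨_, hy⟩, ?_⟩
  rw [cls_apply, LinearEquiv.symm_apply_eq, D.leray_natural p (h₀₁.le.trans h₁₂.le) q c, ← hz,
    NatCochain.Cohomology.map_mk]
  refine congrArg (NatCochain.Cohomology.mk _ q) (Subtype.ext ?_)
  rw [NatCochain.Cohomology.coe_mapCocycles, coe_toCocycle, coe_resZ, val_res]
  exact D.cechHolShrink_cechHolShrink p h₀₁.le h₁₂.le (z : CechHolForms E M (D.U l₂) (D.isOpen l₂) p q)

set_option maxHeartbeats 800000 in
/-- **Controlled solvability** (the cohomological input of the Schwartz/Grauert–Remmert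
finiteness lemma, positive degree): for a bounded cocycle `y` of level `l₁` there are a bounded
cocycle `x` of level `l₂` and a bounded cochain `w` of level `l₀` with
`res res x = res y + δ w` on level `l₀` — represent the class of `y` at level `l₃` (Leray at levels
`l₃` and `l₁`: `res ζ - y = δ η` on level `l₁`), restrict `ζ` to level `l₂` and `η` to level `l₀`.
[cite: GrauertRemmert1977, Kap. VI §4.3] -/
theorem exists_resZ_resZ_eq_add_deltaZ {l₀ l₁ l₂ l₃ : Fin 4} (h₀₁ : l₀ < l₁) (h₁₂ : l₁ < l₂) (h₂₃ : l₂ < l₃)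
    (k : ℕ) (y : ↥(D.Zb p h₁₂ (k + 1))) :
    ∃ (x : ↥(D.Zb p h₂₃ (k + 1))) (w : D.Bdd p l₀ k),
      D.resZ p h₀₁ h₁₂ (k + 1) (D.resZ p h₁₂ h₂₃ (k + 1) x) = D.resZ p h₀₁ h₁₂ (k + 1) y + D.deltaZ p h₀₁ k w := by
  have h₁₃ : l₁ ≤ l₃ := h₁₂.le.trans h₂₃.le
  obtain ⟨z, hz⟩ := NatCochain.Cohomology.mk_surjective _ (k + 1)
    (D.leray p l₃ (k + 1) ((D.leray p l₁ (k + 1)).symm (NatCochain.Cohomology.mk _ (k + 1) (D.toCocycle p h₁₂ (k + 1) y))))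
  have hzδ : cechHolδ E M (D.isOpen l₃) p (k + 1) (z : CechHolForms E M (D.U l₃) (D.isOpen l₃) p (k + 1)) = 0 :=
    (NatCochain.mem_cocycles_iff _).1 z.2
  -- `res_{l₃ → l₁} z - y` is a coboundary of level `l₁`
  have hcob : cechHolShrink E M (D.isOpen l₃) p (D.isOpen l₁) (D.mono l₁ l₃ h₁₃) (k + 1) z - y.1.val ∈
      NatCochain.coboundaries (R := ℂ) (A := CechHolForms E M (D.U l₁) (D.isOpen l₁) p)
        (cechHolδ E M (D.isOpen l₁) p) (k + 1) := by
    have h1 : D.leray p l₁ (k + 1) ((D.leray p l₁ (k + 1)).symm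
        (NatCochain.Cohomology.mk _ (k + 1) (D.toCocycle p h₁₂ (k + 1) y))) =
          NatCochain.Cohomology.mk _ (k + 1) (D.toCocycle p h₁₂ (k + 1) y) :=
      LinearEquiv.apply_symm_apply _ _
    rw [D.leray_natural p h₁₃ (k + 1), ← hz, NatCochain.Cohomology.map_mk, NatCochain.Cohomology.mk_eq_mk_iff,
      NatCochain.Cohomology.coe_mapCocycles, coe_toCocycle] at h1
    exact h1
  obtain ⟨η, hη⟩ := (NatCochain.mem_coboundaries_succ_iff _).1 hcob
  have hx : (⟨_, D.memℓp_cechHolShrink_of_lt p h₂₃ (k + 1) z⟩ : D.Bdd p l₂ (k + 1)) ∈ D.Zb p h₂₃ (k + 1) := by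
    rw [mem_Zb_iff, Bdd.val_mk, ← cechHolShrink_cechHolδ, hzδ, map_zero]
  refine ⟨⟨_, hx⟩, ⟨_, D.memℓp_cechHolShrink_of_lt p h₀₁ k η⟩, ?_⟩
  apply Subtype.ext
  apply Bdd.ext
  have e1 : y.1.val + cechHolδ E M (D.isOpen l₁) p k η =
      cechHolShrink E M (D.isOpen l₃) p (D.isOpen l₁) (D.mono l₁ l₃ h₁₃) (k + 1) z := by
    rw [hη]
    exact add_sub_cancel y.1.val _
  have key : cechHolShrink E M (D.isOpen l₁) p (D.isOpen l₀) (D.mono l₀ l₁ h₀₁.le) (k + 1)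
      (cechHolShrink E M (D.isOpen l₂) p (D.isOpen l₁) (D.mono l₁ l₂ h₁₂.le) (k + 1)
        (cechHolShrink E M (D.isOpen l₃) p (D.isOpen l₂) (D.mono l₂ l₃ h₂₃.le) (k + 1) z)) =
      cechHolShrink E M (D.isOpen l₁) p (D.isOpen l₀) (D.mono l₀ l₁ h₀₁.le) (k + 1) y.1.val +
        cechHolδ E M (D.isOpen l₀) p k (cechHolShrink E M (D.isOpen l₁) p (D.isOpen l₀) (D.mono l₀ l₁ h₀₁.le) k η) := by
    rw [D.cechHolShrink_cechHolShrink p h₁₂.le h₂₃.le, D.cechHolShrink_cechHolShrink p h₀₁.le h₁₃,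
      ← cechHolShrink_cechHolδ, ← map_add, e1, D.cechHolShrink_cechHolShrink p h₀₁.le h₁₃]
  exact key

set_option maxHeartbeats 800000 in
/-- **Controlled solvability in degree `0`**: a bounded `0`-cocycle of level `l₁` is the
restriction of a bounded `0`-cocycle of level `l₂` (no coboundaries in degree `0`).
[cite: GrauertRemmert1977, Kap. VI §4.3] -/
theorem exists_resZ_resZ_eq {l₀ l₁ l₂ l₃ : Fin 4} (h₀₁ : l₀ < l₁) (h₁₂ : l₁ < l₂) (h₂₃ : l₂ < l₃)
    (y : ↥(D.Zb p h₁₂ 0)) :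
    ∃ x : ↥(D.Zb p h₂₃ 0), D.resZ p h₀₁ h₁₂ 0 (D.resZ p h₁₂ h₂₃ 0 x) = D.resZ p h₀₁ h₁₂ 0 y := by
  have h₁₃ : l₁ ≤ l₃ := h₁₂.le.trans h₂₃.le
  obtain ⟨z, hz⟩ := NatCochain.Cohomology.mk_surjective _ 0
    (D.leray p l₃ 0 ((D.leray p l₁ 0).symm (NatCochain.Cohomology.mk _ 0 (D.toCocycle p h₁₂ 0 y))))
  have hzδ : cechHolδ E M (D.isOpen l₃) p 0 (z : CechHolForms E M (D.U l₃) (D.isOpen l₃) p 0) = 0 :=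
    (NatCochain.mem_cocycles_iff _).1 z.2
  have heq : cechHolShrink E M (D.isOpen l₃) p (D.isOpen l₁) (D.mono l₁ l₃ h₁₃) 0 z = (y : D.Bdd p l₁ 0).val := by
    have h1 : NatCochain.Cohomology.mk _ 0 (D.toCocycle p h₁₂ 0 y) =
        D.leray p l₁ 0 ((D.leray p l₁ 0).symm (NatCochain.Cohomology.mk _ 0 (D.toCocycle p h₁₂ 0 y))) :=
      (LinearEquiv.apply_symm_apply _ _).symm
    rw [D.leray_natural p h₁₃ 0, ← hz, NatCochain.Cohomology.map_mk, NatCochain.Cohomology.mk_eq_mk_iff,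
      NatCochain.coboundaries_zero, Submodule.mem_bot, sub_eq_zero, coe_toCocycle,
      NatCochain.Cohomology.coe_mapCocycles] at h1
    exact h1.symm
  have hx : (⟨_, D.memℓp_cechHolShrink_of_lt p h₂₃ 0 z⟩ : D.Bdd p l₂ 0) ∈ D.Zb p h₂₃ 0 := by
    rw [mem_Zb_iff, Bdd.val_mk, ← cechHolShrink_cechHolδ, hzδ, map_zero]
  refine ⟨⟨_, hx⟩, ?_⟩
  apply Subtype.ext
  apply Bdd.ext
  rw [coe_resZ, val_res, coe_resZ, val_res, Bdd.val_mk, coe_resZ, val_res,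
    D.cechHolShrink_cechHolShrink p h₁₂.le h₂₃.le, D.cechHolShrink_cechHolShrink p h₀₁.le h₁₃, ← heq,
    D.cechHolShrink_cechHolShrink p h₀₁.le h₁₃]

end Leray

end DolbeaultLerayDatum

end Literature.Geometry.Kaehler

end
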